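/-
Copyright: cell `pub-ymgap` (HUMAN RULING D-0062), Track A of `YM-PLAN.md`, DAG node N20 (= NE7b); R134 seat `pub-ymgap-dag-n20-d`
(strategy s3 «alternative currency», generation 5), module 6.  Released under the licence of the surrounding project.
-/
import Summits.QuantumFields.YangMills.Theorems.BalabanUVNodesN20LCSAvgExpMoment
import Summits.QuantumFields.YangMills.Theorems.BalabanUVNodesN20LCSAvgTransfer
import HarnessLib

/-!
# YM-DAG node N20 (= NE7b), strategy s3, THE FOURTH CURRENCY «BY VALUE» (module 6, an INSTANCE): THE JOINT EXPONENTIAL MOMENT (JM) AT THE TWO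
# PINNED LEVELS {0, 1} UNDER THE LEVEL-0 LATTICE YANG–MILLS STATE — `∫ e^{δβ Σ_{q∈X}(1 − reTr U(∂q))}·e^{δβ Σ_{p∈Q}(1 − reTr Ū(∂p))} dμ_β
# ≤ e^{C₀δ#X + C₁δ#Q}` (`Ū = avgFun expMeanLogSU U`, `β ≥ 4N`, `0 ≤ δ ≤ δ₀`, uniformly in the volume) — and the JOINT TWO-LEVEL LARGE-FIELD
# SPARSENESS it gives by Chebyshev

Track A of `YM-PLAN.md` (cell `pub-ymgap`, HUMAN RULING D-0062), node **N20** = spine estimate NE7b (`T4WeightBudget.RelWeightBound` — the cell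
`pub-balaban`'s OWN estimate, NOT PRINTED in [Bałaban 1983–89], NOT PROVED).  Seat `pub-ymgap-dag-n20-d` (R134, s3), generation 5, module 6 — the first
INSTANCE of the fourth currency's residual shape beyond one level: modules 2 ∕ 5 (`…N20ByValueExtraction.sum_admS_integral_le_of_jointMoment`,
`…N20ByValueLaws.extractionLaws_byValue_of_jointMoment`) take, per (cutoff, key), ONE joint multiscale exponential moment (JM) of the sacrificed
functionals of ALL pinned levels read on the level-0 field; THIS FILE proves (JM) for the two pinned levels `{0, 1}` at the objects of record —
plaquette energies of the level-0 field `U` and of Bałaban's once-averaged field `Ū = avgFun expMeanLogSU U`, under the level-0 Gibbs state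
`T4GenFunBounds.gibbsMeasure P β` on `SU(N)` fields of a `d = 4` torus.  Kernel theorems only: 0 `def`, 0 `sorry`, standard axioms; COUNT-NEUTRAL
(`--supports` K3‴ `SpineGivenEndpointR13`, stmt-QuantumFields-19912, `--as helper`).  Restate-immune.

WHAT IS PROVED ([folklore]: Cauchy–Schwarz ∕ Chebyshev on two tree theorems; nothing of Bałaban's named or asserted).
* §1 `memLp_two_exp_plaqSum`, `memLp_two_exp_plaqSum_avgFun` (the two carriers are square-integrable under the probability measure `μ_β`: bounded by
  `e^{2|t|#}`), `sq_integral_form` (the Cauchy–Schwarz right member in exponential form).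
* §2 ★★ **`jointExpMoment_levelZero_levelOne`**: for every `N ≥ 1` and `L` there are `δ₀ > 0`, `C₀, C₁ ≥ 0` with: for every `d = 4` parameter set `P`
  (`P.L = L`, `1 ≤ m + K`), every `β ≥ 4N`, every `0 ≤ δ ≤ δ₀`, every finite `X ⊆ Plaq P 0` and `Q ⊆ Plaq P 1`,
    `∫ e^{δβ Σ_{q∈X}(1 − reTr U(∂q))} · e^{δβ Σ_{p∈Q}(1 − reTr Ū(∂p))} dμ_β ≤ e^{C₀δ#X + C₁δ#Q}`
  — CAUCHY–SCHWARZ (`integral_mul_le_Lp_mul_Lq_of_nonneg` at `(2, 2)`) on n20-c's (LS) rung 0 at the record (`N20LCSAtRecordLevelZero.localExpMoment_gibbsMeasure`,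
  tilt `2δ ≤ 1∕12`) and this lineage's (LS) rung 1 (`N20LCSAvgExpMoment.localExpMoment_avgFun`, tilt `2δ ≤ δ₀′`): the located «Hölder divides `δ` by
  the number of pinned levels» at `n = 2` — harmless for two levels, the obstruction along a renewal chain.
* §3 ★ **`gibbsMeasure_jointLargeField_le`** (JOINT TWO-LEVEL LARGE-FIELD SPARSENESS): with those constants, for all thresholds `ε₀, ε₁`,
    `μ_β{U | (∀ q ∈ X, ε₀ ≤ 1 − reTr U(∂q)) ∧ ∀ p ∈ Q, ε₁ ≤ 1 − reTr Ū(∂p)} ≤ e^{C₀δ₀#X + C₁δ₀#Q} · e^{−δ₀β(ε₀#X + ε₁#Q)}`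
  — a prescribed set of large plaquettes of the field AND a prescribed set of large plaquettes of its block average are JOINTLY exponentially rare in
  `β`, per plaquette of either level (`measureReal_and_le_of_jointMoment`, Markov on §2; one-level cases: n20-c's `gibbsMeasure_largeField_le`, this
  lineage's `gibbsMeasure_largeField_avgFun_le`).
* §4 `jointMoment_boltzmann_levelZero_levelOne`: §2 in the `ρ₀·dμ_0` SHAPE modules 2 ∕ 5 consume as `hJM` — `ρ₀ = e^{−βA}` (`Missing.boltzmann P β`),
  `dμ_0 = fieldMeasure P 0 (SU N)`: `∫ (e^{δβΣ_X…}·e^{δβΣ_Q…(Ū)})·e^{−βA} dU ≤ e^{C₀δ#X + C₁δ#Q}·∫ e^{−βA} dU` (`integral_gibbsMeasure`, `Z > 0`).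

HONEST FRAMING.  An INSTANCE with LETTER-BASED constants: `C₁` is the (LS) rung-1 constant (extensive in the averaging box of the domination letter),
`δ₀` is halved by Cauchy–Schwarz; nothing here is `K`-uniform along a renewal chain, and (JM) for three or more levels by the same device divides `δ` by the
number of levels — the located wall of NE7b in the fourth currency is QUANTITATIVE (level-uniform constants), not structural.  Nothing of Bałaban's is
asserted; NE7b NOT PRINTED ∕ NOT PROVED; the (α)-instance 0∕1; N20 NOT discharged (typed 28∕28, discharged count untouched); one finite four-torus programme
at fixed `ε` — NOT ℝ⁴, NOT infinite volume, NOT OS, NOT a mass gap, NOT Clay.  References (LOCATORS only; no decl carries a cite tag): T. Bałaban, CMP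
**122** (1989) 175–202 [Balaban1989LargeFieldI] ((0.1) p. 175); CMP **122** (1989) 355–392 [Balaban1989LargeFieldII] ((1.79) p. 383).
-/

set_option autoImplicit false

noncomputable section

open scoped BigOperators Matrix.Norms.L2Operator
open MeasureTheory
open Literature.MathematicalPhysics.QuantumFieldTheory.Balaban1983to89
open T4Continuum T4ReflectionCone BlockAveraging ExpMeanLog
open Summit.QuantumFields.YangMills.BalabanUVNodes.N20LCSAtRecordLevelZero (localExpMoment_gibbsMeasure)
open Summit.QuantumFields.YangMills.BalabanUVNodes.N20LCSAvgTransfer (measurable_exp_plaqSum_gen abs_exp_plaqSum_gen_le)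
open Summit.QuantumFields.YangMills.BalabanUVNodes.N20LCSAvgExpMoment
  (localExpMoment_avgFun measurable_exp_plaqSum_avgFun abs_exp_plaqSum_avgFun_le)

namespace Summit.QuantumFields.YangMills.BalabanUVNodes.N20ByValueTwoLevelMoment

variable {N : ℕ} [NeZero N]

/-! ## §1 Square-integrability of the two carriers; Markov for a joint event -/

section Helpers

/-- The level-0 carrier `e^{t Σ_{q∈X}(1 − reTr U(∂q))}` is in `L²(μ_β)` (bounded on a probability space), `β ≥ 0`. [folklore] -/
theorem memLp_two_exp_plaqSum (P : Params) {β : ℝ} (hβ : 0 ≤ β) (t : ℝ) (X : Finset (Plaq P 0)) :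
    MemLp (fun U : GaugeField P 0 (Matrix.specialUnitaryGroup (Fin N) ℂ) => Real.exp (t * ∑ q ∈ X, (1 - reTr (GaugeField.plaqHol U q))))
      (ENNReal.ofReal 2) (T4GenFunBounds.gibbsMeasure P β : Measure (GaugeField P 0 (Matrix.specialUnitaryGroup (Fin N) ℂ))) := by
  haveI := T4GenFunBounds.isProbabilityMeasure_gibbsMeasure (G := Matrix.specialUnitaryGroup (Fin N) ℂ) P hβ
  refine MemLp.of_bound (measurable_exp_plaqSum_gen t X).aestronglyMeasurable (Real.exp (|t| * (2 * X.card))) (ae_of_all _ fun U => ?_)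
  rw [Real.norm_eq_abs]
  exact abs_exp_plaqSum_gen_le t X U

/-- The level-1 carrier `e^{t Σ_{p∈Q}(1 − reTr Ū(∂p))}` is in `L²(μ_β)`, `β ≥ 0`. [folklore] -/
theorem memLp_two_exp_plaqSum_avgFun (P : Params) {β : ℝ} (hβ : 0 ≤ β) (t : ℝ) (Q : Finset (Plaq P 1)) :
    MemLp (fun U : GaugeField P 0 (Matrix.specialUnitaryGroup (Fin N) ℂ) =>
        Real.exp (t * ∑ p ∈ Q, (1 - reTr (GaugeField.plaqHol (avgFun (expMeanLogSU (n := Fin N)) U) p))))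
      (ENNReal.ofReal 2) (T4GenFunBounds.gibbsMeasure P β : Measure (GaugeField P 0 (Matrix.specialUnitaryGroup (Fin N) ℂ))) := by
  haveI := T4GenFunBounds.isProbabilityMeasure_gibbsMeasure (G := Matrix.specialUnitaryGroup (Fin N) ℂ) P hβ
  refine MemLp.of_bound (measurable_exp_plaqSum_avgFun P t Q).aestronglyMeasurable (Real.exp (|t| * (2 * Q.card)))
    (ae_of_all _ fun U => ?_)
  rw [Real.norm_eq_abs]
  exact abs_exp_plaqSum_avgFun_le P t Q U

/-- `(∫ (e^{s})² dμ)^{1∕2} ≤ (e^{2b})^{1∕2} = e^{b}` once `∫ e^{2s} dμ ≤ e^{2b}`: the Cauchy–Schwarz factor in exponential form. [folklore] -/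
theorem rpow_half_integral_sq_exp_le {Ω : Type*} [MeasurableSpace Ω] (μ : Measure Ω) (s : Ω → ℝ) {b : ℝ}
    (h : ∫ ω, Real.exp (2 * s ω) ∂μ ≤ Real.exp (2 * b)) :
    (∫ ω, Real.exp (s ω) ^ (2 : ℝ) ∂μ) ^ (1 / (2 : ℝ)) ≤ Real.exp b := by
  have e : (fun ω => Real.exp (s ω) ^ (2 : ℝ)) = fun ω => Real.exp (2 * s ω) := by
    funext ω
    rw [Real.rpow_two, ← Real.exp_nat_mul]
    norm_num
  rw [e]
  have h0 : 0 ≤ ∫ ω, Real.exp (2 * s ω) ∂μ := integral_nonneg fun ω => (Real.exp_pos _).le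
  calc (∫ ω, Real.exp (2 * s ω) ∂μ) ^ (1 / (2 : ℝ)) ≤ (Real.exp (2 * b)) ^ (1 / (2 : ℝ)) :=
        Real.rpow_le_rpow h0 h (by norm_num)
    _ = Real.exp b := by rw [← Real.exp_mul]; ring_nf

/-- **MARKOV FOR A JOINT EVENT OF TWO FAMILIES**: if `F = e^{δβ Σ_X A}·e^{δβ Σ_Q B}` is integrable (`δ, β ≥ 0`), then
`μ{(∀ q ∈ X, ε₀ ≤ A_q) ∧ (∀ p ∈ Q, ε₁ ≤ B_p)} ≤ (∫ F dμ) · e^{−δβ(ε₀#X + ε₁#Q)}`. [folklore] -/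
theorem measureReal_and_le_of_jointMoment {Ω κ₀ κ₁ : Type*} [MeasurableSpace Ω] (μ : Measure Ω) [IsFiniteMeasure μ] (X : Finset κ₀) (Q : Finset κ₁)
    (A : κ₀ → Ω → ℝ) (B : κ₁ → Ω → ℝ) {ε₀ ε₁ δ β : ℝ} (hδ : 0 ≤ δ) (hβ : 0 ≤ β)
    (hint : Integrable (fun ω => Real.exp (δ * β * ∑ q ∈ X, A q ω) * Real.exp (δ * β * ∑ p ∈ Q, B p ω)) μ) :
    μ.real {ω | (∀ q ∈ X, ε₀ ≤ A q ω) ∧ ∀ p ∈ Q, ε₁ ≤ B p ω} ≤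
      (∫ ω, Real.exp (δ * β * ∑ q ∈ X, A q ω) * Real.exp (δ * β * ∑ p ∈ Q, B p ω) ∂μ) *
        Real.exp (-(δ * β * (ε₀ * X.card + ε₁ * Q.card))) := by
  set f : Ω → ℝ := fun ω => Real.exp (δ * β * ∑ q ∈ X, A q ω) * Real.exp (δ * β * ∑ p ∈ Q, B p ω) with hf
  set t : ℝ := Real.exp (δ * β * (ε₀ * X.card + ε₁ * Q.card)) with ht
  have htpos : 0 < t := Real.exp_pos _
  have hδβ : 0 ≤ δ * β := mul_nonneg hδ hβ
  have hsub : {ω | (∀ q ∈ X, ε₀ ≤ A q ω) ∧ ∀ p ∈ Q, ε₁ ≤ B p ω} ⊆ {ω | t ≤ f ω} := by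
    rintro ω ⟨hA, hB⟩
    show t ≤ f ω
    rw [ht, hf]
    dsimp only
    rw [← Real.exp_add]
    refine Real.exp_le_exp.2 ?_
    have hX : ε₀ * X.card ≤ ∑ q ∈ X, A q ω := by
      calc ε₀ * X.card = ∑ _q ∈ X, ε₀ := by rw [Finset.sum_const, nsmul_eq_mul, mul_comm]
        _ ≤ ∑ q ∈ X, A q ω := Finset.sum_le_sum fun q hq => hA q hq
    have hQ : ε₁ * Q.card ≤ ∑ p ∈ Q, B p ω := by
      calc ε₁ * Q.card = ∑ _p ∈ Q, ε₁ := by rw [Finset.sum_const, nsmul_eq_mul, mul_comm]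
        _ ≤ ∑ p ∈ Q, B p ω := Finset.sum_le_sum fun p hp => hB p hp
    calc δ * β * (ε₀ * X.card + ε₁ * Q.card) = δ * β * (ε₀ * X.card) + δ * β * (ε₁ * Q.card) := by ring
      _ ≤ δ * β * ∑ q ∈ X, A q ω + δ * β * ∑ p ∈ Q, B p ω :=
          add_le_add (mul_le_mul_of_nonneg_left hX hδβ) (mul_le_mul_of_nonneg_left hQ hδβ)
  have hmarkov := mul_meas_ge_le_integral_of_nonneg (μ := μ)
    (ae_of_all _ fun ω => mul_nonneg (Real.exp_pos _).le (Real.exp_pos _).le) hint t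
  have h1 : μ.real {ω | (∀ q ∈ X, ε₀ ≤ A q ω) ∧ ∀ p ∈ Q, ε₁ ≤ B p ω} ≤ μ.real {ω | t ≤ f ω} := measureReal_mono hsub
  have h2 : μ.real {ω | t ≤ f ω} ≤ (∫ ω, f ω ∂μ) / t := by
    rw [le_div_iff₀ htpos, mul_comm]
    exact hmarkov
  calc μ.real {ω | (∀ q ∈ X, ε₀ ≤ A q ω) ∧ ∀ p ∈ Q, ε₁ ≤ B p ω} ≤ (∫ ω, f ω ∂μ) / t := h1.trans h2
    _ = (∫ ω, f ω ∂μ) * Real.exp (-(δ * β * (ε₀ * X.card + ε₁ * Q.card))) := by rw [ht, Real.exp_neg, div_eq_mul_inv]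

end Helpers

/-! ## §2 (JM) at the pinned levels {0, 1} under the level-0 Gibbs state -/

section Joint

/-- **THE JOINT EXPONENTIAL MOMENT OF THE PLAQUETTE ENERGIES OF THE FIELD AND OF ITS BLOCK AVERAGE.**  For every `N ≥ 1` and `L` there are `δ₀ > 0` and
`C₀, C₁ ≥ 0` such that for every `d = 4` parameter set `P` with `P.L = L`, `1 ≤ m + K`, every `β ≥ 4N`, every `0 ≤ δ ≤ δ₀` and all finite sets `X` of
level-0 and `Q` of level-1 plaquettes:
  `∫ e^{δβ Σ_{q∈X}(1 − reTr U(∂q))} · e^{δβ Σ_{p∈Q}(1 − reTr Ū(∂p))} d(gibbsMeasure P β) ≤ e^{C₀δ#X + C₁δ#Q}`,  `Ū = avgFun expMeanLogSU U`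
— (JM) of the fourth currency at the two pinned levels `{0, 1}`, uniformly in `β ≥ 4N` and in the volume (Cauchy–Schwarz on the one-level moments of
n20-c's `localExpMoment_gibbsMeasure` and this lineage's `localExpMoment_avgFun` at doubled tilt; `δ₀ = min(1∕24, δ₀′∕2)`). [folklore] -/
theorem jointExpMoment_levelZero_levelOne (N : ℕ) [NeZero N] (L : ℕ) :
    ∃ δ₀ : ℝ, 0 < δ₀ ∧ ∃ C₀ : ℝ, 0 ≤ C₀ ∧ ∃ C₁ : ℝ, 0 ≤ C₁ ∧ ∀ (P : Params), P.d = 4 → P.L = L → 1 ≤ P.m + P.K →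
      ∀ (β : ℝ), 4 * N ≤ β → ∀ (δ : ℝ), 0 ≤ δ → δ ≤ δ₀ → ∀ (X : Finset (Plaq P 0)) (Q : Finset (Plaq P 1)),
        ∫ U, Real.exp (δ * β * ∑ q ∈ X, (1 - reTr (GaugeField.plaqHol U q))) *
              Real.exp (δ * β * ∑ p ∈ Q, (1 - reTr (GaugeField.plaqHol (avgFun (expMeanLogSU (n := Fin N)) U) p)))
            ∂(T4GenFunBounds.gibbsMeasure P β : Measure (GaugeField P 0 (Matrix.specialUnitaryGroup (Fin N) ℂ))) ≤
          Real.exp (C₀ * δ * X.card + C₁ * δ * Q.card) := by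
  obtain ⟨C₀, hC₀, h0⟩ := localExpMoment_gibbsMeasure N
  obtain ⟨δ₁, hδ₁, C₁, hC₁, h1⟩ := localExpMoment_avgFun N L
  refine ⟨min (1 / 24) (δ₁ / 2), lt_min (by norm_num) (half_pos hδ₁), C₀, hC₀, C₁, hC₁,
    fun P hd hL hmK β hβ δ hδ hδle X Q => ?_⟩
  have hNpos : (0 : ℝ) < N := Nat.cast_pos.mpr (Nat.pos_of_ne_zero (NeZero.ne N))
  have hβ0 : 0 ≤ β := le_trans (by positivity) hβ
  have h2δa : 2 * δ ≤ 1 / 12 := by linarith [hδle.trans (min_le_left _ _)]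
  have h2δb : 2 * δ ≤ δ₁ := by linarith [hδle.trans (min_le_right _ _)]
  have h2δ0 : 0 ≤ 2 * δ := by linarith
  set μ := (T4GenFunBounds.gibbsMeasure P β : Measure (GaugeField P 0 (Matrix.specialUnitaryGroup (Fin N) ℂ))) with hμ
  -- the two one-level moments at the doubled tilt
  have hm0 : ∫ U, Real.exp (2 * (δ * β * ∑ q ∈ X, (1 - reTr (GaugeField.plaqHol U q)))) ∂μ ≤ Real.exp (2 * (C₀ * δ * X.card)) := by
    have h := h0 P hd β hβ (2 * δ) h2δ0 h2δa X
    have e1 : (fun U : GaugeField P 0 (Matrix.specialUnitaryGroup (Fin N) ℂ) =>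
        Real.exp (2 * (δ * β * ∑ q ∈ X, (1 - reTr (GaugeField.plaqHol U q))))) =
        fun U => Real.exp (2 * δ * β * ∑ q ∈ X, (1 - reTr (GaugeField.plaqHol U q))) := by
      funext U; ring_nf
    rw [e1, show 2 * (C₀ * δ * (X.card : ℝ)) = C₀ * (2 * δ) * X.card by ring]
    exact h
  have hm1 : ∫ U, Real.exp (2 * (δ * β * ∑ p ∈ Q, (1 - reTr (GaugeField.plaqHol (avgFun (expMeanLogSU (n := Fin N)) U) p)))) ∂μ ≤
      Real.exp (2 * (C₁ * δ * Q.card)) := by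
    have h := h1 P hd hL hmK β hβ (2 * δ) h2δ0 h2δb Q
    have e1 : (fun U : GaugeField P 0 (Matrix.specialUnitaryGroup (Fin N) ℂ) =>
        Real.exp (2 * (δ * β * ∑ p ∈ Q, (1 - reTr (GaugeField.plaqHol (avgFun (expMeanLogSU (n := Fin N)) U) p))))) =
        fun U => Real.exp (2 * δ * β * ∑ p ∈ Q, (1 - reTr (GaugeField.plaqHol (avgFun (expMeanLogSU (n := Fin N)) U) p))) := by
      funext U; ring_nf
    rw [e1, show 2 * (C₁ * δ * (Q.card : ℝ)) = C₁ * (2 * δ) * Q.card by ring]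
    exact h
  -- Cauchy–Schwarz
  have hCS := integral_mul_le_Lp_mul_Lq_of_nonneg (μ := μ) Real.HolderConjugate.two_two
    (ae_of_all _ fun U => (Real.exp_pos _).le) (ae_of_all _ fun U => (Real.exp_pos _).le)
    (memLp_two_exp_plaqSum P hβ0 (δ * β) X) (memLp_two_exp_plaqSum_avgFun P hβ0 (δ * β) Q)
  refine hCS.trans ?_
  rw [show C₀ * δ * (X.card : ℝ) + C₁ * δ * Q.card = (C₀ * δ * X.card) + (C₁ * δ * Q.card) by ring, Real.exp_add]
  exact mul_le_mul (rpow_half_integral_sq_exp_le μ _ hm0) (rpow_half_integral_sq_exp_le μ _ hm1)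
    (Real.rpow_nonneg (integral_nonneg fun U => Real.rpow_nonneg (Real.exp_pos _).le _) _) (Real.exp_pos _).le

end Joint

/-! ## §3 Joint two-level large-field sparseness -/

section Sparseness

/-- **JOINT TWO-LEVEL LARGE-FIELD SPARSENESS UNDER THE LEVEL-0 LATTICE YANG–MILLS STATE.**  With the `δ₀ > 0`, `C₀, C₁ ≥ 0` of
`jointExpMoment_levelZero_levelOne`: for every `d = 4` parameter set `P` (`P.L = L`, `1 ≤ m + K`), every `β ≥ 4N`, all thresholds `ε₀, ε₁` and all finite
sets `X` of level-0 and `Q` of level-1 plaquettes,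
  `μ_β{U | (∀ q ∈ X, ε₀ ≤ 1 − reTr U(∂q)) ∧ ∀ p ∈ Q, ε₁ ≤ 1 − reTr Ū(∂p)} ≤ e^{C₀δ₀#X + C₁δ₀#Q} · e^{−δ₀β(ε₀#X + ε₁#Q)}`
— a prescribed set of large plaquettes of the field AND a prescribed set of large plaquettes of its (0.4) block average are JOINTLY rare, at the rate
`e^{−(δ₀βε₀ − C₀δ₀)}` per level-0 and `e^{−(δ₀βε₁ − C₁δ₀)}` per level-1 plaquette: the two-level case of the joint sparseness (JS) the fourth currency
asks along a pinned genealogy. [folklore] -/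
theorem gibbsMeasure_jointLargeField_le (N : ℕ) [NeZero N] (L : ℕ) :
    ∃ δ₀ : ℝ, 0 < δ₀ ∧ ∃ C₀ : ℝ, 0 ≤ C₀ ∧ ∃ C₁ : ℝ, 0 ≤ C₁ ∧ ∀ (P : Params), P.d = 4 → P.L = L → 1 ≤ P.m + P.K →
      ∀ (β : ℝ), 4 * N ≤ β → ∀ (ε₀ ε₁ : ℝ) (X : Finset (Plaq P 0)) (Q : Finset (Plaq P 1)),
        (T4GenFunBounds.gibbsMeasure P β : Measure (GaugeField P 0 (Matrix.specialUnitaryGroup (Fin N) ℂ))).real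
            {U | (∀ q ∈ X, ε₀ ≤ 1 - reTr (GaugeField.plaqHol U q)) ∧
              ∀ p ∈ Q, ε₁ ≤ 1 - reTr (GaugeField.plaqHol (avgFun (expMeanLogSU (n := Fin N)) U) p)} ≤
          Real.exp (C₀ * δ₀ * X.card + C₁ * δ₀ * Q.card) * Real.exp (-(δ₀ * β * (ε₀ * X.card + ε₁ * Q.card))) := by
  obtain ⟨δ₀, hδ₀, C₀, hC₀, C₁, hC₁, h⟩ := jointExpMoment_levelZero_levelOne N L
  refine ⟨δ₀, hδ₀, C₀, hC₀, C₁, hC₁, fun P hd hL hmK β hβ ε₀ ε₁ X Q => ?_⟩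
  have hNpos : (0 : ℝ) < N := Nat.cast_pos.mpr (Nat.pos_of_ne_zero (NeZero.ne N))
  have hβ0 : 0 ≤ β := le_trans (by positivity) hβ
  haveI := T4GenFunBounds.isProbabilityMeasure_gibbsMeasure (G := Matrix.specialUnitaryGroup (Fin N) ℂ) P hβ0
  have hint : Integrable (fun U : GaugeField P 0 (Matrix.specialUnitaryGroup (Fin N) ℂ) =>
      Real.exp (δ₀ * β * ∑ q ∈ X, (1 - reTr (GaugeField.plaqHol U q))) *
        Real.exp (δ₀ * β * ∑ p ∈ Q, (1 - reTr (GaugeField.plaqHol (avgFun (expMeanLogSU (n := Fin N)) U) p))))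
      (T4GenFunBounds.gibbsMeasure P β : Measure (GaugeField P 0 (Matrix.specialUnitaryGroup (Fin N) ℂ))) := by
    refine (integrable_const (Real.exp (|δ₀ * β| * (2 * X.card)) * Real.exp (|δ₀ * β| * (2 * Q.card)))).mono'
      ((measurable_exp_plaqSum_gen (δ₀ * β) X).mul (measurable_exp_plaqSum_avgFun P (δ₀ * β) Q)).aestronglyMeasurable
      (ae_of_all _ fun U => ?_)
    rw [Real.norm_eq_abs, abs_mul]
    exact mul_le_mul (abs_exp_plaqSum_gen_le (δ₀ * β) X U) (abs_exp_plaqSum_avgFun_le P (δ₀ * β) Q U) (abs_nonneg _)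
      (Real.exp_pos _).le
  have hmarkov := measureReal_and_le_of_jointMoment
    (T4GenFunBounds.gibbsMeasure P β : Measure (GaugeField P 0 (Matrix.specialUnitaryGroup (Fin N) ℂ))) X Q
    (fun q U => 1 - reTr (GaugeField.plaqHol U q))
    (fun p U => 1 - reTr (GaugeField.plaqHol (avgFun (expMeanLogSU (n := Fin N)) U) p)) (ε₀ := ε₀) (ε₁ := ε₁) hδ₀.le hβ0 hint
  exact hmarkov.trans (mul_le_mul_of_nonneg_right (h P hd hL hmK β hβ δ₀ hδ₀.le le_rfl X Q) (Real.exp_pos _).le)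

end Sparseness

/-! ## §4 (JM) in the `ρ₀·dμ_0` shape of modules 2 ∕ 5 -/

section Boltzmann

/-- **(JM) AT LEVELS {0, 1} IN THE SHAPE MODULES 2 ∕ 5 CONSUME** (`hJM` of `…N20ByValueExtraction.sum_admS_integral_le_of_jointMoment` ∕
`…N20ByValueLaws.extractionLaws_byValue_of_jointMoment`: level-0 state `ρ₀·dμ_0` with `ρ₀ = e^{−βA}` the Boltzmann weight `Missing.boltzmann P β` and
`dμ_0 = fieldMeasure P 0 (SU N)` the product Haar measure): with the constants of `jointExpMoment_levelZero_levelOne`,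
  `∫ (e^{δβ Σ_X(1 − reTr U(∂q))}·e^{δβ Σ_Q(1 − reTr Ū(∂p))})·e^{−βA(U)} dU ≤ e^{C₀δ#X + C₁δ#Q}·∫ e^{−βA(U)} dU`
(`T4GenFunBounds.integral_gibbsMeasure`: `∫ F dμ_β = (∫ F·e^{−βA} dU)∕Z`, `Z = ∫ e^{−βA} dU > 0`). [folklore] -/
theorem jointMoment_boltzmann_levelZero_levelOne (N : ℕ) [NeZero N] (L : ℕ) :
    ∃ δ₀ : ℝ, 0 < δ₀ ∧ ∃ C₀ : ℝ, 0 ≤ C₀ ∧ ∃ C₁ : ℝ, 0 ≤ C₁ ∧ ∀ (P : Params), P.d = 4 → P.L = L → 1 ≤ P.m + P.K →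
      ∀ (β : ℝ), 4 * N ≤ β → ∀ (δ : ℝ), 0 ≤ δ → δ ≤ δ₀ → ∀ (X : Finset (Plaq P 0)) (Q : Finset (Plaq P 1)),
        ∫ U, (Real.exp (δ * β * ∑ q ∈ X, (1 - reTr (GaugeField.plaqHol U q))) *
              Real.exp (δ * β * ∑ p ∈ Q, (1 - reTr (GaugeField.plaqHol (avgFun (expMeanLogSU (n := Fin N)) U) p)))) *
            Missing.boltzmann P β U ∂fieldMeasure P 0 (Matrix.specialUnitaryGroup (Fin N) ℂ) ≤
          Real.exp (C₀ * δ * X.card + C₁ * δ * Q.card) *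
            ∫ U, Missing.boltzmann P β U ∂fieldMeasure P 0 (Matrix.specialUnitaryGroup (Fin N) ℂ) := by
  obtain ⟨δ₀, hδ₀, C₀, hC₀, C₁, hC₁, h⟩ := jointExpMoment_levelZero_levelOne N L
  refine ⟨δ₀, hδ₀, C₀, hC₀, C₁, hC₁, fun P hd hL hmK β hβ δ hδ hδle X Q => ?_⟩
  have hNpos : (0 : ℝ) < N := Nat.cast_pos.mpr (Nat.pos_of_ne_zero (NeZero.ne N))
  have hβ0 : 0 ≤ β := le_trans (by positivity) hβ
  have hZ := Missing.partitionFn_pos' (G := Matrix.specialUnitaryGroup (Fin N) ℂ) P hβ0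
  have hmain := h P hd hL hmK β hβ δ hδ hδle X Q
  rw [T4GenFunBounds.integral_gibbsMeasure P hβ0, div_le_iff₀ hZ] at hmain
  exact hmain

end Boltzmann

end Summit.QuantumFields.YangMills.BalabanUVNodes.N20ByValueTwoLevelMoment
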